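import Summits.HubbardSuperconductivity.HubbardSuperconductivity.Theorems.BalabanIRBirComplexStableXYEvenPositivity
import HarnessLib

/-!
# Crux `BirComplexStableXYR` (stmt-HubbardSuperconductivity-14845), `r = 2`, class (R), even `M`:
# the slice-`0` marginal of the complex weight is a positive continuous DENSITY, for every slice observable

Support file (prover seat 0, route BalabanIR).  The tree's `birEven_positiveDensity`
(`…Theorems.BalabanIRBirComplexStableXYEvenPositivity`) represents the partition function `Z` and the
slice-order numerator `N` of the engine (`r = 2`, time-reflection Hermiticity (R), even temporal extent `M`)
as integrals against a continuous density `ρ ≥ 0`, `ρ > 0` on the slice cube, namely the diagonal of the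
Hermitian chain kernel `G_{M-1}(a,a) = ∫ ‖G_{M/2-1}(a,·)‖²`.  Here the same construction is run for an
ARBITRARY bounded continuous slice-`0` observable `g`:

* `birEven_sliceDensity` — `∃ ρ` continuous, `≥ 0`, `> 0` on `[0,2π]^X`, `∫ ρ > 0`, with
  `∫_{[0,2π]^Λ} g(θ(·,0)) e^{-A(θ)} dθ = ∫_{[0,2π]^X} g(a) ρ(a) da` for every continuous bounded `g`.

This is the honest probabilistic content of (R) at `r = 2`: expectations of equal-time slice observables under
the complex weight are expectations under the probability density `ρ/∫ρ` (used by the Jensen free-energy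
transfer, file `…BirComplexStableXYRJensenTransfer`).  Proof: verbatim the tree's argument (currying the cube,
factorisation of `e^{-A}` into two-slice kernels, cyclic trace formula `birChain_integral_cyclic` for the
observable `g`, positivity of the diagonal `birChain_integral_diag_pos`).
-/

noncomputable section

namespace Summit.HubbardSuperconductivity.HubbardSuperconductivity.Theorems

open scoped BigOperators ComplexConjugate
open MeasureTheory
open Literature.Probability.LatticeModels

/-- **Slice density for every slice observable (`r = 2`, class (R), even `M`).** For the objects of the
engine with `r = 2`, a table satisfying the functional form of (R), every real `K`, `L ≥ 1` and even `M ≥ 1`,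
there is a continuous density `ρ ≥ 0` on slice configurations, strictly positive on the slice cube and of
positive total mass, such that for EVERY continuous bounded observable `g` of the time-`0` slice
`∫_{[0,2π]^Λ} g(θ(·,0)) e^{-A θ} dθ = ∫_{[0,2π]^X} g a · ρ a da`.  (`ρ(a) = G_{M-1}(a,a)`, the diagonal of the
Hermitian chain kernel; Osterwalder–Schrader positivity through sites of the nearest-neighbour-in-time chain.)
[folklore] -/
theorem birEven_sliceDensity (c : ((Fin 2 × Fin 2 × Fin 2) → ℤ) →₀ ℂ) (K : ℝ) (L M : ℕ)
    [NeZero L] [NeZero M]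
    (hR : ∀ φ : (Fin 2 × Fin 2 × Fin 2) → ℝ,
      c.sum (fun n a => a * Complex.exp (Complex.I *
        ((∑ w, (n w : ℝ) * φ (w.1, w.2.1, Fin.rev w.2.2) : ℝ) : ℂ))) =
      conj (c.sum (fun n a => a * Complex.exp (Complex.I * ((∑ w, (n w : ℝ) * φ w : ℝ) : ℂ)))))
    (hM : Even M) :
    let sh : (TorusSite 2 L × ZMod M) → (Fin 2 × Fin 2 × Fin 2) → (TorusSite 2 L × ZMod M) :=
      fun s w => (s.1 + ![((w.1 : ℕ) : ZMod L), ((w.2.1 : ℕ) : ZMod L)], s.2 + ((w.2.2 : ℕ) : ZMod M))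
    let F : ((Fin 2 × Fin 2 × Fin 2) → ℝ) → ℂ := fun φ =>
      c.sum (fun n a => a * Complex.exp (Complex.I * ((∑ w, (n w : ℝ) * φ w : ℝ) : ℂ)))
    let A : ((TorusSite 2 L × ZMod M) → ℝ) → ℂ := fun θ => (K : ℂ) * ∑ s, F (fun w => θ (sh s w))
    let cube : Set ((TorusSite 2 L × ZMod M) → ℝ) := Set.pi Set.univ (fun _ => Set.Icc (0:ℝ) (2 * Real.pi))
    ∃ ρ : (TorusSite 2 L → ℝ) → ℝ, Continuous ρ ∧ (∀ a, 0 ≤ ρ a) ∧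
      (∀ a ∈ Set.pi Set.univ (fun _ : TorusSite 2 L => Set.Icc (0:ℝ) (2 * Real.pi)), 0 < ρ a) ∧
      (0 < ∫ a in Set.pi Set.univ (fun _ : TorusSite 2 L => Set.Icc (0:ℝ) (2 * Real.pi)), ρ a) ∧
      ∀ g : (TorusSite 2 L → ℝ) → ℂ, Continuous g → (∃ Cg : ℝ, ∀ a, ‖g a‖ ≤ Cg) →
        MeasureTheory.integral (MeasureTheory.volume.restrict cube)
            (fun θ => g (fun x => θ (x, 0)) * Complex.exp (-(A θ))) =
          ∫ a in Set.pi Set.univ (fun _ : TorusSite 2 L => Set.Icc (0:ℝ) (2 * Real.pi)),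
            g a * ((ρ a : ℝ) : ℂ) := by
  -- `M = 2j + 2`
  obtain ⟨j, rfl⟩ : ∃ j, M = 2 * j + 1 + 1 := by
    obtain ⟨t, ht⟩ := hM
    have h0 : M ≠ 0 := NeZero.ne M
    exact ⟨t - 1, by omega⟩
  intro sh F A cube
  -- the slice cube and its (finite, Lebesgue) measure
  set CX : Set (TorusSite 2 L → ℝ) :=
    Set.pi Set.univ (fun _ : TorusSite 2 L => Set.Icc (0:ℝ) (2 * Real.pi)) with hCX
  set μ : Measure (TorusSite 2 L → ℝ) := volume.restrict CX with hμ
  have hCXm : MeasurableSet CX := MeasurableSet.univ_pi fun _ => measurableSet_Icc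
  have hCXc : IsCompact CX := isCompact_univ_pi fun _ => isCompact_Icc
  haveI : IsFiniteMeasure μ := isFiniteMeasure_restrict.mpr hCXc.measure_lt_top.ne
  have hS : ∀ a ∈ CX, ∀ U : Set (TorusSite 2 L → ℝ), IsOpen U → a ∈ U → 0 < μ U :=
    fun a ha U hU haU => birSliceCube_nhds_pos a ha U hU haU
  have hSae : ∀ᵐ a ∂μ, a ∈ CX := ae_restrict_mem hCXm
  have hμpos : 0 < μ Set.univ := by
    have h0 : (fun _ : TorusSite 2 L => (0:ℝ)) ∈ CX := by
      intro i _
      exact ⟨le_rfl, by positivity⟩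
    exact hS _ h0 Set.univ isOpen_univ (Set.mem_univ _)
  -- the local generating function and the two-slice kernel
  obtain ⟨hFc, hFb⟩ := birLocalF_continuous_bound c
  have hFc' : Continuous F := hFc
  have hFb' : ∀ φ, ‖F φ‖ ≤ ∑ n ∈ c.support, ‖c n‖ := hFb
  have hRF : ∀ φ : (Fin 2 × Fin 2 × Fin 2) → ℝ,
      F (fun w => φ (w.1, w.2.1, Fin.rev w.2.2)) = conj (F φ) := hR
  set k : (TorusSite 2 L → ℝ) → (TorusSite 2 L → ℝ) → ℂ := fun η η' =>
    Complex.exp (-((K : ℂ) * ∑ x : TorusSite 2 L, F (fun w =>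
      (![η, η'] w.2.2) (x + ![((w.1 : ℕ) : ZMod L), ((w.2.1 : ℕ) : ZMod L)])))) with hk
  obtain ⟨hkc, hkb, hkne⟩ := birKernel_continuous_bound (L := L) F hFc' hFb' K
  have hkc' : Continuous (Function.uncurry k) := hkc
  have hkR : ∀ η η', ‖k η η'‖ ≤
      Real.exp (|K| * (Fintype.card (TorusSite 2 L) * ∑ n ∈ c.support, ‖c n‖)) := hkb
  have hkne' : ∀ η η', k η η' ≠ 0 := hkne
  have hkh : ∀ η η', k η' η = conj (k η η') := fun η η' => birKernel_herm F hRF K η η'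
  -- the chain kernels `G n` (kernels of `T^(n+1)`), by recursion
  let G : ℕ → (TorusSite 2 L → ℝ) → (TorusSite 2 L → ℝ) → ℂ := fun n =>
    Nat.rec (motive := fun _ => (TorusSite 2 L → ℝ) → (TorusSite 2 L → ℝ) → ℂ) k
      (fun _ g a b => ∫ c', g a c' * k c' b ∂μ) n
  have hG0 : ∀ a b, G 0 a b = k a b := fun _ _ => rfl
  have hGs : ∀ n a b, G (n + 1) a b = ∫ c', G n a c' * k c' b ∂μ := fun _ _ _ => rfl
  -- currying the cube and the factorisation of the weight
  obtain ⟨e, he, hmp⟩ := birCurry_measurePreserving L (2 * j + 1 + 1)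
  have hfac : ∀ σ : ZMod (2 * j + 1 + 1) → TorusSite 2 L → ℝ,
      Complex.exp (-(A (e σ))) = ∏ τ, k (σ τ) (σ (τ + 1)) := by
    intro σ
    rw [he σ]
    exact birAction_factorises c K L (2 * j + 1 + 1) σ
  -- positivity of the diagonal
  obtain ⟨hint, hpos⟩ :=
    birChain_integral_diag_pos (μ := μ) hkc' hkR hG0 hGs hkh hkne' hS hSae hμpos j
  have hdiag : ∀ a, G (2 * j + 1) a a = (((G (2 * j + 1) a a).re : ℝ) : ℂ) := by
    intro a
    rw [birChain_diag_re_eq hkc' hkR hG0 hGs hkh j a]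
    exact birChain_diag_eq hkc' hkR hG0 hGs hkh j a
  refine ⟨fun a => (G (2 * j + 1) a a).re, ?_, ?_, ?_, hpos, ?_⟩
  · exact Complex.continuous_re.comp ((birChain_continuous hkc' hkR hG0 hGs (2 * j + 1)).comp
      (continuous_id.prodMk continuous_id))
  · intro a
    show 0 ≤ (G (2 * j + 1) a a).re
    rw [birChain_diag_re_eq hkc' hkR hG0 hGs hkh j a]
    exact integral_nonneg fun _ => by positivity
  · intro a ha
    exact birChain_diag_re_pos hkc' hkR hG0 hGs hkh hkne' (hS a ha) j
  -- the trace formula for an arbitrary bounded continuous slice observable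
  intro g hgc hgb
  obtain ⟨Cg, hCg⟩ := hgb
  have h1 := hmp.integral_comp' (fun θ => g (fun x => θ (x, 0)) * Complex.exp (-(A θ)))
  have hge : ∀ σ : ZMod (2 * j + 1 + 1) → TorusSite 2 L → ℝ,
      g (fun x => (e σ) (x, 0)) = g (σ 0) := by
    intro σ
    rw [he σ]
  have h3 := birChain_integral_cyclic (μ := μ) hkc' hkR hG0 hGs hgc hCg (2 * j + 1)
  calc MeasureTheory.integral (MeasureTheory.volume.restrict cube)
        (fun θ => g (fun x => θ (x, 0)) * Complex.exp (-(A θ)))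
        = ∫ θ, g (fun x => θ (x, 0)) * Complex.exp (-(A θ)) ∂(volume.restrict cube) := rfl
    _ = ∫ σ, g (fun x => (e σ) (x, 0)) * Complex.exp (-(A (e σ))) ∂(Measure.pi fun _ => μ) := h1.symm
    _ = ∫ σ : ZMod (2 * j + 1 + 1) → TorusSite 2 L → ℝ, g (σ 0) * ∏ τ : ZMod (2 * j + 1 + 1),
          k (σ τ) (σ (τ + 1)) ∂(Measure.pi fun _ => μ) := by simp_rw [hfac, hge]
    _ = ∫ a, g a * G (2 * j + 1) a a ∂μ := h3
    _ = ∫ a, g a * (((G (2 * j + 1) a a).re : ℝ) : ℂ) ∂μ := by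
          refine integral_congr_ae (Filter.Eventually.of_forall fun a => ?_)
          show g a * G (2 * j + 1) a a = g a * (((G (2 * j + 1) a a).re : ℝ) : ℂ)
          rw [← hdiag a]

end Summit.HubbardSuperconductivity.HubbardSuperconductivity.Theorems

end
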